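import Literature.Topology.FourManifolds.SliceRibbon
import Literature.Topology.Euclidean.InvarianceOfDomain
import HarnessLib

/-!
# Discharge of `Knot.IsTopologicallySlice.exists_isLocallyFlat`: flat discs are locally flat

Sibling proof file of `Literature/Topology/FourManifolds/SliceRibbon.lean`, proving its named
fact `Literature.Topology.FourManifolds.Knot.IsTopologicallySlice.exists_isLocallyFlat` (the **bridge to `IsLocallyFlat`**):
a topologically slice knot `K` bounds, by definition (`Literature.Topology.FourManifolds.Knot.IsTopologicallySlice`,
Freedman–Quinn 1990, §9.3), a *flat* disc, i.e. a map `F : ℝ² × ℝ² → ℝ⁴` which is a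
topological embedding on the product neighbourhood `𝔻² × ℝ²` of the core disc `F (·, 0)`, maps
`𝔻² × ℝ²` into the closed unit ball meeting `𝕊³` exactly along `∂𝔻² × ℝ²`, and restricts to
`K` on `𝕊¹ × {0}`; the fact asserts that the interior of the core, as a map from the open disc
`ball 0 1 ⊆ ℝ²` to the open ball `ball 0 1 ⊆ ℝ⁴`, is then a locally flat embedding in the sense
of `Literature.IsLocallyFlat 2 4` (`Literature/Topology/FourManifolds/LocallyFlat.lean`: an embedding
with local pair charts `(U, U ∩ image) ≅ (ℝ⁴, ℝ² × 0)`).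

## Proof

Write `D = 𝔻²`, `B° ⊆ ℝ²` and `B⁴ ⊆ ℝ⁴` for the open unit balls, `O = B° × ℝ² ⊆ D × ℝ²`.
The core `x ↦ F (x, 0)` restricted to `B° → B⁴` is an embedding because `F` is one on `D × ℝ²`
and `x ↦ (x, 0)` is one. The only non-formal input is **Brouwer's invariance of domain**
(`Literature.Topology.Euclidean.Brouwer.isOpenMap_restrict_of_injOn`,
`Literature/Topology/Euclidean/InvarianceOfDomain.lean`),
which Freedman–Quinn use silently: `F` is continuous and injective on the open subset `O` of the
`4`-dimensional space `ℝ² × ℝ²`, so `F|O` is an open embedding into `ℝ⁴` and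
`U₀ = F '' O ⊆ B⁴` is open. At every interior point `x₀` the chart is the open set `U₀` of `B⁴`
(containing the whole open core) with the homeomorphism
`U₀ ≅ O = B° × ℝ² ≅ ℝ² × ℝ² ≅ ℝ⁴`, composed of `(F|O)⁻¹`, `Homeomorph.unitBall⁻¹ × id` and the
coordinate-appending homeomorphism `ℝ² × ℝ² ≃ₜ ℝ⁴`, `(u, v) ↦ (u₀, u₁, v₀, v₁)`; by injectivity of
`F` on `D × ℝ²`, a point `F (u', v)` of `U₀` lies on the core iff `v = 0`, i.e. iff its image
lies in `ℝ² × 0 = range (euclideanInclusion 2 4)`.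

## References

* M. H. Freedman, F. Quinn, *Topology of 4-manifolds*, Princeton Math. Series 39 (1990), §9.3
  (normal bundles; flat = locally flat embeddings with product neighbourhoods)
  [FreedmanQuinn1990].
* R. J. Daverman, G. A. Venema, *Embeddings in Manifolds*, GSM 106 (2009), §1.1 (locally flat
  embeddings) [DavermanVenema2009].
* Invariance of domain: `Literature/Topology/Euclidean/InvarianceOfDomain.lean` [Tao2014].
-/

open Metric Set Filter Topology

namespace Literature.Topology.FourManifolds

/-- **Discharge of the named fact `Knot.IsTopologicallySlice.exists_isLocallyFlat`** (bridge from
flat discs to `IsLocallyFlat 2 4`). For a topologically slice knot `K`, the flat disc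
`F : ℝ² × ℝ² → ℝ⁴` provided by `K.IsTopologicallySlice` itself witnesses the fact: its core
`x ↦ F (x, 0)`, as a map `ball 0 1 → ball 0 1`, is an embedding, and at each interior point the
open set `U₀ = F '' (ball 0 1 ×ˢ univ)` — open in `ℝ⁴` by Brouwer's invariance of domain
(`Literature.Topology.Euclidean.Brouwer.isOpenMap_restrict_of_injOn`) applied to the continuous injection `F` on the open
subset `ball 0 1 ×ˢ univ` of `ℝ² × ℝ²` — with the homeomorphism
`U₀ ≅ ball 0 1 × ℝ² ≅ ℝ² × ℝ² ≅ ℝ⁴` ((`F|`)⁻¹, then `Homeomorph.unitBall.symm × id`, then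
appending coordinates) is a pair chart sending `U₀ ∩ (core)` onto
`ℝ² × 0 = range (euclideanInclusion 2 4)` (injectivity of `F` on `𝔻² × ℝ²`).
Freedman–Quinn (1990), §9.3; Daverman–Venema (2009), §1.1. [cite: FreedmanQuinn1990, §9.3] -/
theorem Knot.IsTopologicallySlice.exists_isLocallyFlat_holds :
    Knot.IsTopologicallySlice.exists_isLocallyFlat := by
  intro K hK
  obtain ⟨F, hF⟩ := hK
  refine ⟨F, hF, ?_⟩
  obtain ⟨hemb, hnorm, -⟩ := hF
  -- abbreviations
  set D : Set (EuclideanSpace ℝ (Fin 2)) := closedBall 0 1 with hD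
  set Bo : Set (EuclideanSpace ℝ (Fin 2)) := ball 0 1 with hBo
  set B4 : Set (EuclideanSpace ℝ (Fin 4)) := ball 0 1 with hB4
  have hmaps := Knot.IsTopologicallySlice.mapsTo hnorm
  set f : Bo → B4 := hmaps.restrict with hf
  -- continuity and injectivity of `F` on `D × ℝ²`
  have hFcont : ContinuousOn F (D ×ˢ univ) :=
    continuousOn_iff_continuous_restrict.mpr hemb.continuous
  have hFinj : InjOn F (D ×ˢ univ) := injOn_iff_injective.mpr hemb.injective
  -- the open set `O = B° × ℝ²` and invariance of domain
  set O : Set (EuclideanSpace ℝ (Fin 2) × EuclideanSpace ℝ (Fin 2)) := Bo ×ˢ univ with hO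
  have hOopen : IsOpen O := isOpen_ball.prod isOpen_univ
  have hOD : O ⊆ D ×ˢ univ := prod_mono ball_subset_closedBall Subset.rfl
  have hrank : Module.finrank ℝ (EuclideanSpace ℝ (Fin 2) × EuclideanSpace ℝ (Fin 2)) =
      Module.finrank ℝ (EuclideanSpace ℝ (Fin 4)) := by
    simp [Module.finrank_prod]
  have hFO : IsOpenEmbedding (O.restrict F) :=
    .of_continuous_injective_isOpenMap (hFcont.mono hOD).restrict (hFinj.mono hOD).injective
      (Euclidean.Brouwer.isOpenMap_restrict_of_injOn hrank hOopen (hFcont.mono hOD) (hFinj.mono hOD))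
  -- the image of `O` lies in the open 4-ball
  have hOB4 : ∀ p ∈ O, F p ∈ B4 := by
    rintro ⟨x, w⟩ ⟨hx, -⟩
    rw [hB4, mem_ball_zero_iff]
    rw [hBo, mem_ball_zero_iff] at hx
    obtain ⟨hle, hiff⟩ := hnorm x w hx.le
    exact lt_of_le_of_ne hle fun h => hx.ne (hiff.mp h)
  -- the core `x ↦ F (x, 0)` on the open disc is an embedding into the open 4-ball
  have hι : IsEmbedding fun x : EuclideanSpace ℝ (Fin 2) => (x, (0 : EuclideanSpace ℝ (Fin 2))) :=
    IsEmbedding.of_leftInverse (f := Prod.fst) (fun _ => rfl) continuous_fst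
      (continuous_id.prodMk continuous_const)
  have hj : IsEmbedding fun x : Bo =>
      (⟨((x : EuclideanSpace ℝ (Fin 2)), (0 : EuclideanSpace ℝ (Fin 2))),
        ⟨ball_subset_closedBall x.2, mem_univ _⟩⟩ :
          ↥(D ×ˢ (univ : Set (EuclideanSpace ℝ (Fin 2))))) :=
    (hι.comp IsEmbedding.subtypeVal).codRestrict (D ×ˢ univ) _
  have hf_emb : IsEmbedding f := by
    have := (hemb.comp hj).codRestrict B4 (fun x => hmaps x.2)
    rw [hf]
    exact this
  refine ⟨hf_emb, fun x₀ => ?_⟩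
  -- the open piece `U₀ = F (B° × ℝ²)` of the open 4-ball and the corresponding open set of `B⁴`
  have hU₀open : IsOpen (range (O.restrict F)) := hFO.isOpen_range
  have hU₀B4 : range (O.restrict F) ⊆ B4 := by
    rintro _ ⟨p, rfl⟩
    exact hOB4 p p.2
  refine ⟨⟨Subtype.val ⁻¹' range (O.restrict F), hU₀open.preimage continuous_subtype_val⟩, ?_, ?_⟩
  · show (f x₀ : EuclideanSpace ℝ (Fin 4)) ∈ range (O.restrict F)
    exact ⟨⟨((x₀ : EuclideanSpace ℝ (Fin 2)), 0), x₀.2, mem_univ _⟩, rfl⟩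
  -- `ℝ² × ℝ² ≃ₜ ℝ⁴`, appending coordinates
  let A : EuclideanSpace ℝ (Fin 2) × EuclideanSpace ℝ (Fin 2) → EuclideanSpace ℝ (Fin 4) := fun p =>
    WithLp.toLp 2 fun i : Fin 4 => if h : (i : ℕ) < 2 then p.1 ⟨i, h⟩ else p.2 ⟨i - 2, by omega⟩
  let Ainv : EuclideanSpace ℝ (Fin 4) → EuclideanSpace ℝ (Fin 2) × EuclideanSpace ℝ (Fin 2) :=
    fun z => (WithLp.toLp 2 fun i : Fin 2 => z ⟨i, by omega⟩,
      WithLp.toLp 2 fun i : Fin 2 => z ⟨i + 2, by omega⟩)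
  have hAcont : Continuous A := by
    refine (PiLp.continuous_toLp 2 _).comp (continuous_pi fun i => ?_)
    split_ifs with h
    · exact (PiLp.continuous_apply 2 _ _).comp continuous_fst
    · exact (PiLp.continuous_apply 2 _ _).comp continuous_snd
  have hAinvcont : Continuous Ainv := by
    refine Continuous.prodMk ?_ ?_
    · exact (PiLp.continuous_toLp 2 _).comp (continuous_pi fun i => PiLp.continuous_apply 2 _ _)
    · exact (PiLp.continuous_toLp 2 _).comp (continuous_pi fun i => PiLp.continuous_apply 2 _ _)
  have hA_incl : ∀ u : EuclideanSpace ℝ (Fin 2), A (u, 0) = euclideanInclusion 2 4 u := by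
    intro u
    ext i
    simp only [A, euclideanInclusion_apply]
    split_ifs with h <;> simp
  obtain ⟨h₄, hh₄⟩ : ∃ h₄ : (EuclideanSpace ℝ (Fin 2) × EuclideanSpace ℝ (Fin 2)) ≃ₜ
      EuclideanSpace ℝ (Fin 4), ∀ p, h₄ p = A p :=
    ⟨{ toFun := A
       invFun := Ainv
       left_inv := by
         rintro ⟨u, v⟩
         simp only [A, Ainv, Prod.mk.injEq]
         constructor
         · ext i
           have hi : (i : ℕ) < 2 := i.isLt
           simp [hi]
         · ext i
           fin_cases i <;> rfl
       right_inv := by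
         intro z
         simp only [A, Ainv]
         ext i
         fin_cases i <;> rfl
       continuous_toFun := hAcont
       continuous_invFun := hAinvcont }, fun p => rfl⟩
  have hA_range : ∀ u v : EuclideanSpace ℝ (Fin 2),
      h₄ (u, v) ∈ range (euclideanInclusion 2 4) ↔ v = 0 := by
    intro u v
    constructor
    · rintro ⟨u', hu'⟩
      rw [← hA_incl, ← hh₄] at hu'
      have := h₄.injective hu'
      simp only [Prod.mk.injEq] at this
      exact this.2.symm
    · rintro rfl
      exact ⟨u, by rw [hh₄, hA_incl]⟩
  -- the chart `φ : U ≃ₜ ℝ⁴`, kept abstract through its defining property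
  obtain ⟨φ, hφsymm⟩ : ∃ φ : (⟨Subtype.val ⁻¹' range (O.restrict F),
      hU₀open.preimage continuous_subtype_val⟩ : TopologicalSpace.Opens B4) ≃ₜ
      EuclideanSpace ℝ (Fin 4), ∀ u v : EuclideanSpace ℝ (Fin 2),
        ((φ.symm (h₄ (u, v)) : B4) : EuclideanSpace ℝ (Fin 4)) =
          F (((Homeomorph.unitBall u : Bo) : EuclideanSpace ℝ (Fin 2)), v) := by
    let toU₀ : (⟨Subtype.val ⁻¹' range (O.restrict F), hU₀open.preimage continuous_subtype_val⟩ :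
        TopologicalSpace.Opens B4) ≃ₜ range (O.restrict F) :=
      { toFun := fun y => ⟨y.1.1, y.2⟩
        invFun := fun z => ⟨⟨z.1, hU₀B4 z.2⟩, z.2⟩
        left_inv := fun y => rfl
        right_inv := fun z => rfl
        continuous_toFun := (continuous_subtype_val.comp continuous_subtype_val).subtype_mk _
        continuous_invFun := (continuous_subtype_val.subtype_mk _).subtype_mk _ }
    refine ⟨toU₀.trans (hFO.isEmbedding.toHomeomorph.symm.trans ((Homeomorph.Set.prod Bo univ).trans
      (((Homeomorph.unitBall (E := EuclideanSpace ℝ (Fin 2))).symm.prodCongr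
        (Homeomorph.Set.univ (EuclideanSpace ℝ (Fin 2)))).trans h₄))), fun u v => ?_⟩
    simp only [Homeomorph.symm_trans_apply, Homeomorph.symm_apply_apply,
      Homeomorph.prodCongr_symm, Homeomorph.symm_symm]
    rfl
  refine ⟨φ, ?_⟩
  ext z
  obtain ⟨⟨u, v⟩, rfl⟩ := h₄.surjective z
  rw [hA_range]
  constructor
  · rintro ⟨y, hy, hyz⟩
    have hy' : φ.symm (h₄ (u, v)) = y := by rw [← hyz, Homeomorph.symm_apply_apply]
    obtain ⟨x, hx⟩ := hy
    have hval : ((y : B4) : EuclideanSpace ℝ (Fin 4)) = F ((x : EuclideanSpace ℝ (Fin 2)), 0) := by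
      rw [← hx, hf, MapsTo.val_restrict_apply]
    have h1 : F ((x : EuclideanSpace ℝ (Fin 2)), 0) =
        F (((Homeomorph.unitBall u : Bo) : EuclideanSpace ℝ (Fin 2)), v) := by
      rw [← hval, ← hφsymm u v, hy']
    have hxD : ((x : EuclideanSpace ℝ (Fin 2)), (0 : EuclideanSpace ℝ (Fin 2))) ∈ D ×ˢ univ :=
      ⟨ball_subset_closedBall x.2, mem_univ _⟩
    have huD : (((Homeomorph.unitBall u : Bo) : EuclideanSpace ℝ (Fin 2)), v) ∈ D ×ˢ univ :=
      ⟨ball_subset_closedBall (Homeomorph.unitBall u).2, mem_univ _⟩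
    have h2 := hFinj hxD huD h1
    rw [Prod.mk.injEq] at h2
    exact h2.2.symm
  · rintro rfl
    refine ⟨φ.symm (h₄ (u, 0)), ?_, φ.apply_symm_apply _⟩
    show (φ.symm (h₄ (u, 0)) : B4) ∈ range f
    refine ⟨Homeomorph.unitBall u, ?_⟩
    apply Subtype.ext
    rw [hf, MapsTo.val_restrict_apply, hφsymm]

end Literature.Topology.FourManifolds
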